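/-
Copyright (c) 2026 the pub-hodgecm-mathlib formalisation cell (harness21).  Prover seat hodgecm-mathlib-A-p12 (g25): road «S3-ram» (LEAD F0P3a-plan (g13); (Cnt2′) chair
F0P3a-p07 (g15) RULING (13) organ (4b), RULING (16)(a) regime B; (α) keeper F0P3a-p06 (g16)); organ (K4b) of the (4b) decomposition, PART 2/3 (the kind tokens); 2026-09-02.
-/
import Literature.NumberTheory.Rogawski1990.DepthZeroKappaTransferTypeTwoRamifiedHyperbolicVertexFrame      -- ★/filed (K4b) 1/3 (this seat): the adapted axis frame; brings (K4a), (K3)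
import Literature.NumberTheory.Automorphic.UnitaryLatticeTreeCentredTokensDictionary                    -- ★ (F0P3a-p07): `sub_smul_one_mulVec_coe_mulVec`
import HarnessLib

/-!
# The ramified `κ`-orbital integral, TYPE (2): THE KIND TOKENS `Pin` ∕ `Qbig` AND THE LOCK `Λ(c₁)` OF THE HYPERBOLIC BLOCK LITERAL, READ ON AN ADAPTED AXIS FRAME
# (organ (4b), part (K4b) 2/3; Kottwitz 1986 §3; Rogawski 1990 §4.9; Labesse–Langlands 1979 §2)

Topic `NumberTheory/Rogawski1990`; namespace `Literature.NumberTheory.Rogawski1990.TypeOneRamifiedJunction`.  THEOREMS ONLY (no definition, no instance, no notation, no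
named fact, no `sorry`); kernel lane `--supports stmt-HodgeConjecture-24833`; datum-free.  Cell `pub/hodgecm-mathlib` (D-0151), crux H413; road «S3-ram» (count-neutral);
(Cnt2′) ROUTE B, chair RULING (13) organ **(4b)**, RULING (16)(a) «regime B» (A-p12 (g25)), part (K4b) 2/3.  In an adapted AXIS block frame `u = ι(k,1)` of a region vertex
`v = u·r₀` (`↑(u⁻¹γu) = ι(g₁,1)`, `tr g₁ = 2c`, (K4b) 1/3 `exists_adaptedAxisFrame_of_mem_rootRegion`) the VERTEX-LEVEL kind tokens of the (4a) ∕ (K5-B-J) heads (F0P3-p03 (g16)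
`regionCensus_block_of_kindCounts`, F0P3a-p08 (g21)) — stated on the W-part `{y ∈ v.1 ∣ y₁ = 0}` of the axis lattice against the CENTRED literal `Γ − c·1` — are the residual
keys of ★ (K4a) `blockVertexCensus_{shell,inner}`:
* §1 bookkeeping: `ι(g₁,1) − c·1` acts blockwise; `u·z ∈ ϖ^e·(u·L₀) ⟺ z ∈ ϖ^e·L₀`; the `J₀`-pairing written out;
* §2 **`inner_token_iff_of_axisFrame`**: `Pin v :≡ (∀ y ∈ v.1, y₁ = 0 → (Γ − c·1)y ∈ ϖ^{d₀+1}·v.1) ⟺ |ϖ^{−d₀}g₁,₀₁| < 1` (`⟺ res LO = 0`; ★ (K3) `v_apply_zero_one_lt_one_iff_centred_lt_one`);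
* §3 **`residue_CO_eq_neg_residue_T₀`** (`CO = ϖ^{−d₀}(1 − g₁,₀₀)`, `T₀ = ϖ^{−d₀}(c − 1)`, regime B `|c − 1| = |ϖ|^{d₀}` ⇒ `res CO = −res T₀ ≠ 0`) and **`lock_iff_quadraticChar`**:
  `Λ(c₁) :≡ (∃ a, |a| = 1 ∧ |T₀ − c₁a²| < 1) ⟺ χ((res nc₁)⁻¹·res CO) = 1` (`nc₁ = −c₁`) — chair RULING (15);
* §4 **`big_token_iff_of_axisFrame`** (shell vertex, `res LO ≠ 0`): `Qbig v :≡ (∃ y ∈ v.1, y₁ = 0 ∧ ∃ a, |a| = 1 ∧ |ϖ^{−d₀}⟨y, (Γ − c·1)y⟩ − T₀a²| < 1) ⟺ χ(−(res LO·res CO)) = 1`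
  (the residual value on the W-part is `l̄·x̄₂²`).
HONEST LABEL: HC_CM is proved only modulo the 2 remaining named inputs (hLiu418 24832, h413 24833) until rung 0 closes; nothing printed is asserted here (lattice
bookkeeping over ★ results); «S3-ram» is Literature seeding, count-neutral.

## References
* [Kottwitz1986] R. E. Kottwitz, *Base change for unit elements of Hecke algebras*, Compositio Math. 60 (1986), §3.
* [Rogawski1990] J. D. Rogawski, *Automorphic Representations of Unitary Groups in Three Variables*, Ann. of Math. Stud. 123 (1990), §4.8 Case (a) p. 53, §4.9 pp. 54–56, Lemma 4.9.3.
* [LabesseLanglands1979] J.-P. Labesse, R. P. Langlands, *L-indistinguishability for SL(2)*, Canad. J. Math. 31 (1979), §2 Lemma 2.1.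
* [BruhatTits1972] F. Bruhat, J. Tits, *Groupes réductifs sur un corps local I*, Publ. Math. IHÉS 41 (1972), §10.
* [IrelandRosen1990] K. Ireland, M. Rosen, *A Classical Introduction to Modern Number Theory*, GTM 84 (1990), Ch. 8 §1.
-/

set_option autoImplicit false

noncomputable section

open scoped Valued WithZero Matrix MatrixGroups
open Polynomial Classical SimpleGraph
open Literature.NumberTheory.Automorphic Literature.NumberTheory.Automorphic.HermitianLattice Literature.NumberTheory.Automorphic.UnitaryLatticeTree
open Literature.NumberTheory.Automorphic.UnitaryGroup

namespace Literature.NumberTheory.Rogawski1990.TypeOneRamifiedJunction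

variable {K : Type*} [Field K] [Valued K ℤᵐ⁰] {σ : K →+* K} {ϖ : K}

/-! ## §1 Bookkeeping on an axis frame -/

omit [Valued K ℤᵐ⁰] in
/-- The CENTRED block frame literal acts blockwise: `(ι(a,1) − c·1)·x = ((a − c)·(x₀,x₂) on W, (1 − c)·x₁ on e₁)`, written out. [cite: Rogawski1990, §4.8 Case (a) p. 53] -/
theorem coe_endoGL_one_sub_smul_one_mulVec (a : GL (Fin 2) K) (c : K) (x : Fin 3 → K) :
    (((endoGL (a, (1 : GL (Fin 1) K)) : GL (Fin 3) K) : Matrix (Fin 3) (Fin 3) K) - c • (1 : Matrix (Fin 3) (Fin 3) K)) *ᵥ x =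
      ![((a : Matrix (Fin 2) (Fin 2) K) 0 0 - c) * x 0 + (a : Matrix (Fin 2) (Fin 2) K) 0 1 * x 2, (1 - c) * x 1,
        (a : Matrix (Fin 2) (Fin 2) K) 1 0 * x 0 + ((a : Matrix (Fin 2) (Fin 2) K) 1 1 - c) * x 2] := by
  rw [coe_endoGL_eq_endoShape, Units.val_one]
  ext i
  fin_cases i <;> simp [Matrix.mulVec, dotProduct, Fin.sum_univ_three, Matrix.one_apply]

omit [Valued K ℤᵐ⁰] in
/-- The `J₀ = antidiag(1,1,1)` pairing written out: `⟨x, z⟩ = σx₀·z₂ + σx₁·z₁ + σx₂·z₀`. [cite: Rogawski1990, §1.9 p. 8] -/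
theorem pairing_antidiagonal_three_apply (σ : K →+* K) (x z : Fin 3 → K) :
    pairing σ ((StdForm.antidiagonal 3).over K) x z = σ (x 0) * z 2 + σ (x 1) * z 1 + σ (x 2) * z 0 := by
  rw [antidiagonal_three_over_eq, pairing_apply]
  simp [Fin.sum_univ_three]

/-- `A·z ∈ r·(A·L₀) ⟺ z ∈ r·L₀`, i.e. `|zᵢ| ≤ |r|` for all `i` (`A` invertible, `r ≠ 0`). [cite: Serre1980Trees, Ch. II §1.1] [cite: BruhatTits1972, §10] -/
theorem coe_mulVec_mem_scaleLattice_latt_iff (A : GL (Fin 3) K) {r : K} (hr : r ≠ 0) (z : Fin 3 → K) :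
    (A : Matrix (Fin 3) (Fin 3) K) *ᵥ z ∈ scaleLattice r (latt (A : Matrix (Fin 3) (Fin 3) K)) ↔ ∀ i, Valued.v (z i) ≤ Valued.v r := by
  have hA : IsUnit (A : Matrix (Fin 3) (Fin 3) K).det := Matrix.isUnits_det_units A
  have hvr : Valued.v r ≠ 0 := (Valuation.ne_zero_iff _).2 hr
  rw [mem_scaleLattice_iff hr, ← Matrix.mulVec_smul, mem_latt_iff_of_isUnit hA, Matrix.mulVec_mulVec, Matrix.nonsing_inv_mul _ hA, Matrix.one_mulVec,
    mem_stdLattice]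
  refine forall_congr' fun i => ?_
  rw [Pi.smul_apply, smul_eq_mul, map_mul, map_inv₀, inv_mul_le_iff₀ (zero_lt_iff.2 hvr), mul_one]

/-- The frame identity `v.1 = u·L₀ = latt ↑u` of `v = u·r₀`. [cite: BruhatTits1972, §10] -/
theorem coe_eq_latt_of_eq_latticeGraphIso_root (hϖ : Valued.v ϖ = WithZero.exp (-1 : ℤ)) (u : unitaryGroupOfForm σ ((StdForm.antidiagonal 3).over K))
    {v : {M : Submodule 𝒪[K] (Fin 3 → K) // IsVertex σ ϖ ((StdForm.antidiagonal 3).over K) M}}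
    (hvu : v = latticeGraphIso σ ϖ ((StdForm.antidiagonal 3).over K) u ⟨stdLattice K 3, 0, isSelfDualLattice_stdLattice_three_of_v hϖ⟩) :
    v.1 = latt (((u : GL (Fin 3) K)) : Matrix (Fin 3) (Fin 3) K) := by
  rw [hvu, latticeGraphIso_apply_coe]; rfl

omit [Valued K ℤᵐ⁰] in
/-- The inverse of an axis frame is an axis frame: `(↑ι(k,1))⁻¹·y` has middle coordinate `y₁`. [cite: Rogawski1990, §4.8 Case (a) p. 53] -/
theorem coe_endoGL_one_inv_mulVec_apply_one (k : GL (Fin 2) K) (y : Fin 3 → K) :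
    (((endoGL (k, (1 : GL (Fin 1) K)) : GL (Fin 3) K) : Matrix (Fin 3) (Fin 3) K)⁻¹ *ᵥ y) 1 = y 1 := by
  rw [← Matrix.coe_units_inv, ← map_inv, Prod.inv_mk, inv_one, coe_endoGL_one_mulVec_apply_one]

omit [Valued K ℤᵐ⁰] in
/-- The CENTRED literal through the frame: `(Γ − c·1)·(u·x) = u·((ι(g₁,1) − c·1)·x)` when `↑(u⁻¹γu) = ι(g₁,1)`. [cite: Kottwitz1986, §3] -/
theorem sub_smul_one_mulVec_frame (γ u : unitaryGroupOfForm σ ((StdForm.antidiagonal 3).over K)) (g₁ : GL (Fin 2) K)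
    (hγu : ((u⁻¹ * γ * u : unitaryGroupOfForm σ ((StdForm.antidiagonal 3).over K)) : GL (Fin 3) K) = endoGL (g₁, (1 : GL (Fin 1) K))) (c : K) (x : Fin 3 → K) :
    ((((γ : GL (Fin 3) K) : Matrix (Fin 3) (Fin 3) K)) - c • (1 : Matrix (Fin 3) (Fin 3) K)) *ᵥ ((((u : GL (Fin 3) K)) : Matrix (Fin 3) (Fin 3) K) *ᵥ x) =
      (((u : GL (Fin 3) K)) : Matrix (Fin 3) (Fin 3) K) *ᵥ
        (((((endoGL (g₁, (1 : GL (Fin 1) K)) : GL (Fin 3) K) : Matrix (Fin 3) (Fin 3) K)) - c • (1 : Matrix (Fin 3) (Fin 3) K)) *ᵥ x) := by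
  rw [sub_smul_one_mulVec_coe_mulVec, ← Subgroup.coe_inv, ← Subgroup.coe_mul, ← Subgroup.coe_mul, hγu]

omit [Valued K ℤᵐ⁰] in
/-- In a block frame with `tr g₁ = 2c`: `g₁,₀₀ − c = ½((g₁−1)₀₀ − (g₁−1)₁₁)` and `g₁,₁₁ − c = −½((g₁−1)₀₀ − (g₁−1)₁₁)` (`2 ≠ 0`). [cite: Rogawski1990, §4.9 Lemma 4.9.3 p. 56] -/
theorem apply_sub_centre_eq_of_trace (h2 : (2 : K) ≠ 0) (g₁ : Matrix (Fin 2) (Fin 2) K) {c : K} (hc : g₁.trace = 2 * c) :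
    g₁ 0 0 - c = ((g₁ - 1) 0 0 - (g₁ - 1) 1 1) / 2 ∧ g₁ 1 1 - c = -(((g₁ - 1) 0 0 - (g₁ - 1) 1 1) / 2) := by
  rw [Matrix.trace_fin_two] at hc
  simp only [Matrix.sub_apply, Matrix.one_apply_eq]
  constructor
  · field_simp; linear_combination hc
  · field_simp; linear_combination hc

/-! ## §2 The INNER token `Pin` is the interior key `res LO = 0` -/

set_option maxHeartbeats 1600000 in
/-- **(K4b-T1) `Pin v ⟺ |ϖ^{−d₀} g₁,₀₁| < 1`** on an adapted, J-symmetric AXIS block frame `u = ι(k,1)` of `v = u·r₀` (`↑(u⁻¹γu) = ι(g₁,1)`, `tr g₁ = 2c`, `|2| = 1`):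
the W-part `{y ∈ v.1 ∣ y₁ = 0} = u·(𝒪e₀ ⊕ 𝒪e₂)` is mapped by `Γ − c·1` into `ϖ^{d₀+1}·v.1` iff the centred block `g₁ − c·1` is `≡ 0 (mod ϖ^{d₀+1})` iff (★ (K3)
`v_apply_zero_one_lt_one_iff_centred_lt_one`) `|ϖ^{−d₀}g₁,₀₁| < 1` — INNER vertex ⟺ `res LO = 0` in ★ (K4a). [cite: Kottwitz1986, §3] [cite: Rogawski1990, §4.9 Lemma 4.9.3 p. 56]
[cite: LabesseLanglands1979, §2 Lemma 2.1] -/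
theorem inner_token_iff_of_axisFrame (hϖ : Valued.v ϖ = WithZero.exp (-1 : ℤ)) (h2 : Valued.v (2 : K) = 1)
    (γ u : unitaryGroupOfForm σ ((StdForm.antidiagonal 3).over K)) (k : GL (Fin 2) K) (hu : (u : GL (Fin 3) K) = endoGL (k, (1 : GL (Fin 1) K)))
    {v : {M : Submodule 𝒪[K] (Fin 3 → K) // IsVertex σ ϖ ((StdForm.antidiagonal 3).over K) M}}
    (hvu : v = latticeGraphIso σ ϖ ((StdForm.antidiagonal 3).over K) u ⟨stdLattice K 3, 0, isSelfDualLattice_stdLattice_three_of_v hϖ⟩)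
    (g₁ : GL (Fin 2) K) (hγu : ((u⁻¹ * γ * u : unitaryGroupOfForm σ ((StdForm.antidiagonal 3).over K)) : GL (Fin 3) K) = endoGL (g₁, (1 : GL (Fin 1) K)))
    {c : K} (hc : (g₁ : Matrix (Fin 2) (Fin 2) K).trace = 2 * c) {d₀ : ℕ}
    (hadapt : Valued.v ((ϖ ^ d₀)⁻¹ * (g₁ : Matrix (Fin 2) (Fin 2) K) 1 0) < 1)
    (hsym : Valued.v ((ϖ ^ d₀)⁻¹ * ((((g₁ : Matrix (Fin 2) (Fin 2) K) - 1) 0 0) - (((g₁ : Matrix (Fin 2) (Fin 2) K) - 1) 1 1))) < 1) :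
    (∀ y ∈ v.1, y 1 = 0 → (((γ : GL (Fin 3) K) : Matrix (Fin 3) (Fin 3) K) - c • (1 : Matrix (Fin 3) (Fin 3) K)) *ᵥ y ∈ scaleLattice (ϖ ^ (d₀ + 1)) v.1) ↔
      Valued.v ((ϖ ^ d₀)⁻¹ * (g₁ : Matrix (Fin 2) (Fin 2) K) 0 1) < 1 := by
  have hϖ0 : ϖ ≠ 0 := fun h0 => by rw [h0, map_zero] at hϖ; exact WithZero.coe_ne_zero hϖ.symm
  have hϖe0 : (ϖ ^ (d₀ + 1) : K) ≠ 0 := pow_ne_zero _ hϖ0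
  have h20 : (2 : K) ≠ 0 := fun h0 => by rw [h0, map_zero] at h2; exact zero_ne_one h2
  have hU : IsUnit (((u : GL (Fin 3) K)) : Matrix (Fin 3) (Fin 3) K).det := Matrix.isUnits_det_units _
  have hv1 := coe_eq_latt_of_eq_latticeGraphIso_root hϖ u hvu
  have hc2 : (g₁ : Matrix (Fin 2) (Fin 2) K).trace / 2 = c := by rw [hc]; field_simp
  constructor
  · intro hPin
    -- test vector `y = u·e₂` (the W-direction `e₂` of the frame)
    have hx : (Pi.single 2 1 : Fin 3 → K) ∈ stdLattice K 3 := mem_stdLattice.2 fun i => by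
      rcases eq_or_ne i 2 with rfl | hi
      · rw [Pi.single_eq_same, map_one]
      · rw [Pi.single_eq_of_ne hi, map_zero]; exact zero_le_one
    have hy : (((u : GL (Fin 3) K)) : Matrix (Fin 3) (Fin 3) K) *ᵥ (Pi.single 2 1 : Fin 3 → K) ∈ v.1 := by rw [hv1]; exact mulVec_mem_latt _ hx
    have hy1 : ((((u : GL (Fin 3) K)) : Matrix (Fin 3) (Fin 3) K) *ᵥ (Pi.single 2 1 : Fin 3 → K)) 1 = 0 := by
      rw [hu, coe_endoGL_one_mulVec_apply_one, Pi.single_eq_of_ne (by decide)]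
    have h := hPin _ hy hy1
    rw [sub_smul_one_mulVec_frame γ u g₁ hγu, hv1, coe_mulVec_mem_scaleLattice_latt_iff _ hϖe0] at h
    have h0 := h 0
    rw [coe_endoGL_one_sub_smul_one_mulVec] at h0
    simp only [Fin.isValue, Matrix.cons_val_zero, Pi.single_eq_of_ne (show (0 : Fin 3) ≠ 2 by decide), Pi.single_eq_same, mul_zero, mul_one,
      zero_add, map_pow] at h0
    exact (v_inv_pow_mul_lt_one_iff hϖ d₀ _).2 h0
  · intro h01 y hy hy1
    -- every centred block entry is `≤ |ϖ|^{d₀+1}` (★ (K3))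
    have hcen := (v_apply_zero_one_lt_one_iff_centred_lt_one h2 (g₁ : Matrix (Fin 2) (Fin 2) K) hadapt hsym).1 h01
    rw [hc2] at hcen
    have hent : ∀ i j, Valued.v ((((g₁ : Matrix (Fin 2) (Fin 2) K)) - c • (1 : Matrix (Fin 2) (Fin 2) K)) i j) ≤ Valued.v ϖ ^ (d₀ + 1) := fun i j =>
      (v_inv_pow_mul_lt_one_iff hϖ d₀ _).1 (hcen i j)
    have e00 := hent 0 0; have e01 := hent 0 1; have e10 := hent 1 0; have e11 := hent 1 1
    simp only [Matrix.sub_apply, Matrix.smul_apply, Matrix.one_apply_eq, Matrix.one_apply_ne (show (0 : Fin 2) ≠ 1 by decide),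
      Matrix.one_apply_ne (show (1 : Fin 2) ≠ 0 by decide), smul_eq_mul, mul_one, mul_zero, sub_zero] at e00 e01 e10 e11
    -- coordinates of `y` on the frame
    set x : Fin 3 → K := ((((u : GL (Fin 3) K)) : Matrix (Fin 3) (Fin 3) K))⁻¹ *ᵥ y with hxdef
    have hxO : x ∈ stdLattice K 3 := (mem_latt_iff_of_isUnit hU y).1 (by rw [← hv1]; exact hy)
    have hyx : y = (((u : GL (Fin 3) K)) : Matrix (Fin 3) (Fin 3) K) *ᵥ x := by
      rw [hxdef, Matrix.mulVec_mulVec, Matrix.mul_nonsing_inv _ hU, Matrix.one_mulVec]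
    have hx1 : x 1 = 0 := by rw [hxdef, hu, coe_endoGL_one_inv_mulVec_apply_one]; exact hy1
    have hxi : ∀ i, Valued.v (x i) ≤ 1 := mem_stdLattice.1 hxO
    have hbd : ∀ {a b : K}, Valued.v a ≤ Valued.v ϖ ^ (d₀ + 1) → Valued.v b ≤ Valued.v ϖ ^ (d₀ + 1) →
        Valued.v (a * x 0 + b * x 2) ≤ Valued.v (ϖ ^ (d₀ + 1)) := by
      intro a b ha hb
      rw [map_pow]
      refine (Valuation.map_add _ _ _).trans (max_le ?_ ?_)
      · rw [map_mul]; exact (mul_le_mul' ha (hxi 0)).trans_eq (mul_one _)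
      · rw [map_mul]; exact (mul_le_mul' hb (hxi 2)).trans_eq (mul_one _)
    rw [hyx, sub_smul_one_mulVec_frame γ u g₁ hγu, hv1, coe_mulVec_mem_scaleLattice_latt_iff _ hϖe0, coe_endoGL_one_sub_smul_one_mulVec]
    intro i
    fin_cases i
    · exact hbd e00 e01
    · simp only [Fin.mk_one, Fin.isValue, Matrix.cons_val_one, Matrix.cons_val_zero, hx1, mul_zero, map_zero]; exact zero_le
    · exact hbd e10 e11

/-! ## §3 The scalar key `res CO = −res T₀ ≠ 0` and the LOCK `Λ(c₁)` -/

/-- **(K4b-T2) THE SCALAR KEY.**  In a J-symmetric block frame with `tr g₁ = 2c` (`|2| = 1`) and `CO = ϖ^{−d₀}(1 − g₁,₀₀)`, `T₀ = ϖ^{−d₀}(c − 1)`: `res CO = −res T₀`; and in REGIME B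
(`|c − 1| = |ϖ|^{d₀}`) `res T₀ ≠ 0`, so `res CO ≠ 0` — the `hc` binder of ★ (K4a). [cite: Rogawski1990, §4.9 Lemma 4.9.3 p. 56] [cite: Kottwitz1986, §3] -/
theorem residue_CO_eq_neg_residue_T₀ (hϖ : Valued.v ϖ = WithZero.exp (-1 : ℤ)) (h2 : Valued.v (2 : K) = 1)
    (g₁ : Matrix (Fin 2) (Fin 2) K) {c : K} (hc : g₁.trace = 2 * c) {d₀ : ℕ}
    (hsym : Valued.v ((ϖ ^ d₀)⁻¹ * (((g₁ - 1) 0 0) - ((g₁ - 1) 1 1))) < 1) (hcB : Valued.v (c - 1) = Valued.v ϖ ^ d₀)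
    (CO : 𝒪[K]) (hCO : (CO : K) = (ϖ ^ d₀)⁻¹ * (((1 : GL (Fin 1) K) : Matrix (Fin 1) (Fin 1) K) 0 0 - g₁ 0 0))
    (T₀ : 𝒪[K]) (hT₀ : (T₀ : K) = (ϖ ^ d₀)⁻¹ * (c - 1)) :
    IsLocalRing.residue 𝒪[K] CO = -IsLocalRing.residue 𝒪[K] T₀ ∧ IsLocalRing.residue 𝒪[K] T₀ ≠ 0 ∧ IsLocalRing.residue 𝒪[K] CO ≠ 0 := by
  have hϖ0 : ϖ ≠ 0 := fun h0 => by rw [h0, map_zero] at hϖ; exact WithZero.coe_ne_zero hϖ.symm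
  have hvϖ0 : Valued.v ϖ ≠ 0 := (Valuation.ne_zero_iff _).2 hϖ0
  have h20 : (2 : K) ≠ 0 := fun h0 => by rw [h0, map_zero] at h2; exact zero_ne_one h2
  have hv2 : Valued.v ((2 : K)⁻¹) = 1 := by rw [map_inv₀, h2, inv_one]
  have hT : Valued.v (T₀ : K) = 1 := by
    rw [hT₀, map_mul, map_inv₀, map_pow, hcB, inv_mul_cancel₀ (pow_ne_zero _ hvϖ0)]
  have hT0 : IsLocalRing.residue 𝒪[K] T₀ ≠ 0 := residue_ne_zero_of_v_eq_one T₀ hT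
  have hsum : IsLocalRing.residue 𝒪[K] (CO + T₀) = 0 := by
    rw [residue_eq_zero_iff_v_lt_one]
    push_cast
    have e : (ϖ ^ d₀)⁻¹ * ((((1 : GL (Fin 1) K) : Matrix (Fin 1) (Fin 1) K) 0 0) - g₁ 0 0) + (ϖ ^ d₀)⁻¹ * (c - 1) =
        -((2 : K)⁻¹ * ((ϖ ^ d₀)⁻¹ * (((g₁ - 1) 0 0) - ((g₁ - 1) 1 1)))) := by
      rw [Units.val_one, Matrix.one_apply_eq, show (1 : K) - g₁ 0 0 = -(g₁ 0 0 - c) - (c - 1) by ring, (apply_sub_centre_eq_of_trace h20 g₁ hc).1]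
      ring
    rw [hCO, hT₀, e, Valuation.map_neg, map_mul, hv2, one_mul]
    exact hsym
  have hCOeq : IsLocalRing.residue 𝒪[K] CO = -IsLocalRing.residue 𝒪[K] T₀ := by
    rw [eq_neg_iff_add_eq_zero, ← map_add]; exact hsum
  exact ⟨hCOeq, hT0, by rw [hCOeq]; exact neg_ne_zero.2 hT0⟩

/-- **(K4b-T3) THE LOCK `Λ(c₁)` IS (K4a)'s lock character** (chair RULING (15)): for units `T₀, c₁` with `res CO = −res T₀` and `nc₁ = −c₁`:
`(∃ a, |a| = 1 ∧ |T₀ − c₁·a²| < 1) ⟺ χ((res nc₁)⁻¹·res CO) = 1`; otherwise the character is `−1`. [cite: Rogawski1990, §4.9 p. 55] [cite: IrelandRosen1990, Ch. 8 §1] -/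
theorem lock_iff_quadraticChar [Fintype 𝓀[K]] [DecidableEq 𝓀[K]] (c₁ : K) (hc₁ : Valued.v c₁ = 1) (nc₁ : 𝒪[K]) (hnc₁ : (nc₁ : K) = -c₁)
    (CO T₀ : 𝒪[K]) (hCOT : IsLocalRing.residue 𝒪[K] CO = -IsLocalRing.residue 𝒪[K] T₀) (hT0 : IsLocalRing.residue 𝒪[K] T₀ ≠ 0) :
    ((∃ a : K, Valued.v a = 1 ∧ Valued.v ((T₀ : K) - c₁ * a ^ 2) < 1) ↔
        quadraticChar 𝓀[K] ((IsLocalRing.residue 𝒪[K] nc₁)⁻¹ * IsLocalRing.residue 𝒪[K] CO) = 1) ∧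
      ((¬ ∃ a : K, Valued.v a = 1 ∧ Valued.v ((T₀ : K) - c₁ * a ^ 2) < 1) ↔
        quadraticChar 𝓀[K] ((IsLocalRing.residue 𝒪[K] nc₁)⁻¹ * IsLocalRing.residue 𝒪[K] CO) = -1) := by
  obtain ⟨C₁, hC₁⟩ : ∃ C₁ : 𝒪[K], (C₁ : K) = c₁ := ⟨⟨c₁, (Valuation.mem_integer_iff _ _).2 hc₁.le⟩, rfl⟩
  have hC0 : IsLocalRing.residue 𝒪[K] C₁ ≠ 0 := residue_ne_zero_of_v_eq_one C₁ (by rw [hC₁]; exact hc₁)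
  have hnc : nc₁ = -C₁ := Subtype.ext (by push_cast; rw [hnc₁, hC₁])
  have hkey : (IsLocalRing.residue 𝒪[K] nc₁)⁻¹ * IsLocalRing.residue 𝒪[K] CO = (IsLocalRing.residue 𝒪[K] C₁)⁻¹ * IsLocalRing.residue 𝒪[K] T₀ := by
    rw [hnc, map_neg, hCOT, inv_neg, neg_mul_neg]
  have hne : (IsLocalRing.residue 𝒪[K] C₁)⁻¹ * IsLocalRing.residue 𝒪[K] T₀ ≠ 0 := mul_ne_zero (inv_ne_zero hC0) hT0
  have hiff : (∃ a : K, Valued.v a = 1 ∧ Valued.v ((T₀ : K) - c₁ * a ^ 2) < 1) ↔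
      quadraticChar 𝓀[K] ((IsLocalRing.residue 𝒪[K] nc₁)⁻¹ * IsLocalRing.residue 𝒪[K] CO) = 1 := by
    rw [hkey, ← hC₁, exists_unit_v_sub_mul_sq_lt_one_iff_residue T₀ C₁, exists_ne_zero_eq_mul_sq_iff_quadraticChar hC0]
  refine ⟨hiff, ?_⟩
  rw [hiff, hkey]
  exact (quadraticChar_eq_neg_one_iff_not_one hne).symm

/-! ## §4 The BIG token `Qbig` at a shell vertex is the class key `χ(−l̄c̄) = 1` -/

/-- Residues agree along `σ` (residually trivial `σ`): `res σx = res x` for `x ∈ 𝒪`. [cite: Tits1979, §3.5] -/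
theorem residue_mk_map_eq (hvσ : ∀ a, Valued.v (σ a) = Valued.v a) (hres : ∀ x : K, Valued.v x ≤ 1 → Valued.v (σ x - x) < 1)
    (x : K) (hx : Valued.v x ≤ 1) :
    IsLocalRing.residue 𝒪[K] ⟨σ x, (Valuation.mem_integer_iff _ _).2 ((hvσ x).le.trans hx)⟩ = IsLocalRing.residue 𝒪[K] ⟨x, (Valuation.mem_integer_iff _ _).2 hx⟩ := by
  rw [← sub_eq_zero, ← map_sub, residue_eq_zero_iff_v_lt_one]
  exact hres x hx

set_option maxHeartbeats 3200000 in
/-- **(K4b-T4) `Qbig v ⟺ χ(−(res LO·res CO)) = 1` AT A SHELL VERTEX** (`res LO ≠ 0`) on an adapted, J-symmetric AXIS block frame (`tr g₁ = 2c`, `res CO = −res T₀ ≠ 0`):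
for `y = u·x` with `x₁ = 0` the value `ϖ^{−d₀}⟨y, (Γ − c·1)y⟩ = σx₀(m̄x₀ + ā₁₁x₂) + σx₂(ā₀₀x₀ + l·x₂)` has residue `l̄·x̄₂²` (`m̄ = ā₀₀ = ā₁₁ = 0` residually), so
«`∃` such `y` and a unit `a` with `|value − T₀a²| < 1`» iff `l̄x̄₂² = t̄₀ā²` is solvable with `ā ≠ 0` iff `χ(l̄t̄₀) = 1` iff `χ(−l̄c̄) = 1` — BIG ⟺ kind «A» of B-p14 (g40). [cite: Kottwitz1986, §3]
[cite: Rogawski1990, §4.9 Prop. 4.9.1 (b) p. 55] [cite: LabesseLanglands1979, §2 Lemma 2.1] [cite: IrelandRosen1990, Ch. 8 §1] -/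
theorem big_token_iff_of_axisFrame [Fintype 𝓀[K]] [DecidableEq 𝓀[K]]
    (hvσ : ∀ a, Valued.v (σ a) = Valued.v a) (hϖ : Valued.v ϖ = WithZero.exp (-1 : ℤ))
    (hres : ∀ x : K, Valued.v x ≤ 1 → Valued.v (σ x - x) < 1) (h2 : Valued.v (2 : K) = 1)
    (γ u : unitaryGroupOfForm σ ((StdForm.antidiagonal 3).over K)) (k : GL (Fin 2) K) (hu : (u : GL (Fin 3) K) = endoGL (k, (1 : GL (Fin 1) K)))
    {v : {M : Submodule 𝒪[K] (Fin 3 → K) // IsVertex σ ϖ ((StdForm.antidiagonal 3).over K) M}}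
    (hvu : v = latticeGraphIso σ ϖ ((StdForm.antidiagonal 3).over K) u ⟨stdLattice K 3, 0, isSelfDualLattice_stdLattice_three_of_v hϖ⟩)
    (g₁ : GL (Fin 2) K) (hγu : ((u⁻¹ * γ * u : unitaryGroupOfForm σ ((StdForm.antidiagonal 3).over K)) : GL (Fin 3) K) = endoGL (g₁, (1 : GL (Fin 1) K)))
    {c : K} (hc : (g₁ : Matrix (Fin 2) (Fin 2) K).trace = 2 * c) {d₀ : ℕ}
    (hadapt : Valued.v ((ϖ ^ d₀)⁻¹ * (g₁ : Matrix (Fin 2) (Fin 2) K) 1 0) < 1)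
    (hsym : Valued.v ((ϖ ^ d₀)⁻¹ * ((((g₁ : Matrix (Fin 2) (Fin 2) K) - 1) 0 0) - (((g₁ : Matrix (Fin 2) (Fin 2) K) - 1) 1 1))) < 1)
    (CO T₀ : 𝒪[K]) (hCOT : IsLocalRing.residue 𝒪[K] CO = -IsLocalRing.residue 𝒪[K] T₀) (hT0 : IsLocalRing.residue 𝒪[K] T₀ ≠ 0)
    (LO : 𝒪[K]) (hLO : (LO : K) = (ϖ ^ d₀)⁻¹ * (g₁ : Matrix (Fin 2) (Fin 2) K) 0 1) (hl : IsLocalRing.residue 𝒪[K] LO ≠ 0) :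
    (∃ y ∈ v.1, y 1 = 0 ∧ ∃ a : K, Valued.v a = 1 ∧
        Valued.v ((ϖ ^ d₀)⁻¹ * pairing σ ((StdForm.antidiagonal 3).over K) y
          ((((γ : GL (Fin 3) K) : Matrix (Fin 3) (Fin 3) K) - c • (1 : Matrix (Fin 3) (Fin 3) K)) *ᵥ y) - (T₀ : K) * a ^ 2) < 1) ↔
      quadraticChar 𝓀[K] (-(IsLocalRing.residue 𝒪[K] LO * IsLocalRing.residue 𝒪[K] CO)) = 1 := by
  have hϖ0 : ϖ ≠ 0 := fun h0 => by rw [h0, map_zero] at hϖ; exact WithZero.coe_ne_zero hϖ.symm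
  have hvϖ0 : Valued.v ϖ ≠ 0 := (Valuation.ne_zero_iff _).2 hϖ0
  have hϖD0 : (ϖ ^ d₀ : K) ≠ 0 := pow_ne_zero _ hϖ0
  have h20 : (2 : K) ≠ 0 := fun h0 => by rw [h0, map_zero] at h2; exact zero_ne_one h2
  have hv2 : Valued.v ((2 : K)⁻¹) = 1 := by rw [map_inv₀, h2, inv_one]
  have hU : IsUnit (((u : GL (Fin 3) K)) : Matrix (Fin 3) (Fin 3) K).det := Matrix.isUnits_det_units _
  have hv1 := coe_eq_latt_of_eq_latticeGraphIso_root hϖ u hvu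
  have hneg : -(IsLocalRing.residue 𝒪[K] LO * IsLocalRing.residue 𝒪[K] CO) = IsLocalRing.residue 𝒪[K] LO * IsLocalRing.residue 𝒪[K] T₀ := by
    rw [hCOT, mul_neg, neg_neg]
  rw [hneg]
  -- the integral scaled entries of the centred block
  have hvD : Valued.v ((ϖ ^ d₀)⁻¹ : K) * Valued.v ϖ ^ d₀ = 1 := by rw [← map_pow, ← map_mul, inv_mul_cancel₀ hϖD0, map_one]
  have hint : ∀ z : K, Valued.v z ≤ Valued.v ϖ ^ d₀ → Valued.v ((ϖ ^ d₀)⁻¹ * z) ≤ 1 := fun z hz => by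
    rw [map_mul]; exact (mul_le_mul' le_rfl hz).trans_eq hvD
  have hcen := apply_sub_centre_eq_of_trace h20 (g₁ : Matrix (Fin 2) (Fin 2) K) hc
  have hA00v : Valued.v ((ϖ ^ d₀)⁻¹ * ((g₁ : Matrix (Fin 2) (Fin 2) K) 0 0 - c)) < 1 := by
    rw [hcen.1, show (ϖ ^ d₀)⁻¹ * ((((g₁ : Matrix (Fin 2) (Fin 2) K) - 1) 0 0 - ((g₁ : Matrix (Fin 2) (Fin 2) K) - 1) 1 1) / 2) =
      (2 : K)⁻¹ * ((ϖ ^ d₀)⁻¹ * ((((g₁ : Matrix (Fin 2) (Fin 2) K) - 1) 0 0) - (((g₁ : Matrix (Fin 2) (Fin 2) K) - 1) 1 1))) by ring, map_mul, hv2, one_mul]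
    exact hsym
  have hA11v : Valued.v ((ϖ ^ d₀)⁻¹ * ((g₁ : Matrix (Fin 2) (Fin 2) K) 1 1 - c)) < 1 := by
    rw [hcen.2, mul_neg, Valuation.map_neg, ← hcen.1]; exact hA00v
  obtain ⟨A00, hA00⟩ : ∃ A : 𝒪[K], (A : K) = (ϖ ^ d₀)⁻¹ * ((g₁ : Matrix (Fin 2) (Fin 2) K) 0 0 - c) := ⟨⟨_, (Valuation.mem_integer_iff _ _).2 hA00v.le⟩, rfl⟩
  obtain ⟨A11, hA11⟩ : ∃ A : 𝒪[K], (A : K) = (ϖ ^ d₀)⁻¹ * ((g₁ : Matrix (Fin 2) (Fin 2) K) 1 1 - c) := ⟨⟨_, (Valuation.mem_integer_iff _ _).2 hA11v.le⟩, rfl⟩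
  obtain ⟨M10, hM10⟩ : ∃ A : 𝒪[K], (A : K) = (ϖ ^ d₀)⁻¹ * (g₁ : Matrix (Fin 2) (Fin 2) K) 1 0 := ⟨⟨_, (Valuation.mem_integer_iff _ _).2 hadapt.le⟩, rfl⟩
  have rA00 : IsLocalRing.residue 𝒪[K] A00 = 0 := by rw [residue_eq_zero_iff_v_lt_one, hA00]; exact hA00v
  have rA11 : IsLocalRing.residue 𝒪[K] A11 = 0 := by rw [residue_eq_zero_iff_v_lt_one, hA11]; exact hA11v
  have rM10 : IsLocalRing.residue 𝒪[K] M10 = 0 := by rw [residue_eq_zero_iff_v_lt_one, hM10]; exact hadapt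
  -- the residual value on the W-part of the frame: `l̄·x̄₂²`
  have hval : ∀ x : Fin 3 → K, (hx : ∀ i, Valued.v (x i) ≤ 1) → x 1 = 0 →
      ∃ V : 𝒪[K], (V : K) = (ϖ ^ d₀)⁻¹ * pairing σ ((StdForm.antidiagonal 3).over K) ((((u : GL (Fin 3) K)) : Matrix (Fin 3) (Fin 3) K) *ᵥ x)
          ((((γ : GL (Fin 3) K) : Matrix (Fin 3) (Fin 3) K) - c • (1 : Matrix (Fin 3) (Fin 3) K)) *ᵥ ((((u : GL (Fin 3) K)) : Matrix (Fin 3) (Fin 3) K) *ᵥ x)) ∧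
        IsLocalRing.residue 𝒪[K] V = IsLocalRing.residue 𝒪[K] LO * IsLocalRing.residue 𝒪[K] ⟨x 2, (Valuation.mem_integer_iff _ _).2 (hx 2)⟩ ^ 2 := by
    intro x hx hx1
    have hσ0 : Valued.v (σ (x 0)) ≤ 1 := (hvσ _).le.trans (hx 0)
    have hσ2 : Valued.v (σ (x 2)) ≤ 1 := (hvσ _).le.trans (hx 2)
    refine ⟨⟨σ (x 0), (Valuation.mem_integer_iff _ _).2 hσ0⟩ * (M10 * ⟨x 0, (Valuation.mem_integer_iff _ _).2 (hx 0)⟩ + A11 * ⟨x 2, (Valuation.mem_integer_iff _ _).2 (hx 2)⟩) +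
      ⟨σ (x 2), (Valuation.mem_integer_iff _ _).2 hσ2⟩ * (A00 * ⟨x 0, (Valuation.mem_integer_iff _ _).2 (hx 0)⟩ + LO * ⟨x 2, (Valuation.mem_integer_iff _ _).2 (hx 2)⟩), ?_, ?_⟩
    · rw [sub_smul_one_mulVec_frame γ u g₁ hγu, pairing_mulVec_mulVec_of_mem_unitary u.2, coe_endoGL_one_sub_smul_one_mulVec, pairing_antidiagonal_three_apply]
      push_cast
      rw [hM10, hA11, hA00, hLO, hx1]
      simp only [Fin.isValue, map_zero, mul_zero, add_zero]
      ring
    · simp only [map_add, map_mul, rM10, rA11, rA00, zero_mul, add_zero, mul_zero, zero_add]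
      rw [residue_mk_map_eq hvσ hres (x 2) (hx 2)]
      ring
  constructor
  · rintro ⟨y, hy, hy1, a, ha, hlt⟩
    set x : Fin 3 → K := ((((u : GL (Fin 3) K)) : Matrix (Fin 3) (Fin 3) K))⁻¹ *ᵥ y with hxdef
    have hxO : x ∈ stdLattice K 3 := (mem_latt_iff_of_isUnit hU y).1 (by rw [← hv1]; exact hy)
    have hyx : y = (((u : GL (Fin 3) K)) : Matrix (Fin 3) (Fin 3) K) *ᵥ x := by
      rw [hxdef, Matrix.mulVec_mulVec, Matrix.mul_nonsing_inv _ hU, Matrix.one_mulVec]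
    have hx1 : x 1 = 0 := by rw [hxdef, hu, coe_endoGL_one_inv_mulVec_apply_one]; exact hy1
    have hxi : ∀ i, Valued.v (x i) ≤ 1 := mem_stdLattice.1 hxO
    obtain ⟨V, hV, hrV⟩ := hval x hxi hx1
    rw [hyx, ← hV] at hlt
    obtain ⟨b, hb0, hb⟩ := (exists_unit_v_sub_mul_sq_lt_one_iff_residue V T₀).1 ⟨a, ha, hlt⟩
    rw [hrV] at hb
    -- `l̄ x̄₂² = t̄₀ b² ≠ 0`, so `l̄ t̄₀ = (t̄₀ b ∕ x̄₂)²`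
    have hx2 : IsLocalRing.residue 𝒪[K] ⟨x 2, (Valuation.mem_integer_iff _ _).2 (hxi 2)⟩ ≠ 0 := by
      intro h0
      rw [h0, zero_pow two_ne_zero, mul_zero] at hb
      exact (mul_ne_zero hT0 (pow_ne_zero 2 hb0)) hb.symm
    have hsq : IsLocalRing.residue 𝒪[K] LO * IsLocalRing.residue 𝒪[K] T₀ =
        (IsLocalRing.residue 𝒪[K] T₀ * b * (IsLocalRing.residue 𝒪[K] ⟨x 2, (Valuation.mem_integer_iff _ _).2 (hxi 2)⟩)⁻¹) ^ 2 := by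
      have hinv : IsLocalRing.residue 𝒪[K] ⟨x 2, (Valuation.mem_integer_iff _ _).2 (hxi 2)⟩ * (IsLocalRing.residue 𝒪[K] ⟨x 2, (Valuation.mem_integer_iff _ _).2 (hxi 2)⟩)⁻¹ = 1 :=
        mul_inv_cancel₀ hx2
      linear_combination (IsLocalRing.residue 𝒪[K] T₀ * (IsLocalRing.residue 𝒪[K] ⟨x 2, (Valuation.mem_integer_iff _ _).2 (hxi 2)⟩)⁻¹ ^ 2) * hb +
        (-(IsLocalRing.residue 𝒪[K] LO * IsLocalRing.residue 𝒪[K] T₀) *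
          (IsLocalRing.residue 𝒪[K] ⟨x 2, (Valuation.mem_integer_iff _ _).2 (hxi 2)⟩ * (IsLocalRing.residue 𝒪[K] ⟨x 2, (Valuation.mem_integer_iff _ _).2 (hxi 2)⟩)⁻¹ + 1)) * hinv
    rw [hsq]
    exact quadraticChar_sq_one' (by
      refine mul_ne_zero (mul_ne_zero hT0 hb0) (inv_ne_zero hx2))
  · intro hχ
    have hne : IsLocalRing.residue 𝒪[K] LO * IsLocalRing.residue 𝒪[K] T₀ ≠ 0 := mul_ne_zero hl hT0
    obtain ⟨r, hr⟩ := (quadraticChar_one_iff_isSquare hne).1 hχ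
    -- test vector `y = u·(T₀·e₂)`
    have hT1 : Valued.v (T₀ : K) ≤ 1 := T₀.2
    set x : Fin 3 → K := Pi.single 2 (T₀ : K) with hxdef
    have hxi : ∀ i, Valued.v (x i) ≤ 1 := fun i => by
      rcases eq_or_ne i 2 with rfl | hi
      · rw [hxdef, Pi.single_eq_same]; exact hT1
      · rw [hxdef, Pi.single_eq_of_ne hi, map_zero]; exact zero_le_one
    have hx1 : x 1 = 0 := by rw [hxdef, Pi.single_eq_of_ne (by decide)]
    have hx2 : (⟨x 2, (Valuation.mem_integer_iff _ _).2 (hxi 2)⟩ : 𝒪[K]) = T₀ := Subtype.ext (by simp [hxdef])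
    refine ⟨(((u : GL (Fin 3) K)) : Matrix (Fin 3) (Fin 3) K) *ᵥ x, by rw [hv1]; exact mulVec_mem_latt _ (mem_stdLattice.2 hxi), by
      rw [hu, coe_endoGL_one_mulVec_apply_one, hx1], ?_⟩
    obtain ⟨V, hV, hrV⟩ := hval x hxi hx1
    rw [← hV]
    refine (exists_unit_v_sub_mul_sq_lt_one_iff_residue V T₀).2 ⟨r, fun h0 => hne (by rw [hr, h0, mul_zero]), ?_⟩
    rw [hrV, hx2]
    linear_combination IsLocalRing.residue 𝒪[K] T₀ * hr

end Literature.NumberTheory.Rogawski1990.TypeOneRamifiedJunction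

end
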